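import Mathlib.Algebra.Polynomial.FieldDivision
import Mathlib.Algebra.Polynomial.Roots
import Mathlib.Algebra.Polynomial.AlgebraMap
import Mathlib.RingTheory.PrincipalIdealDomain
import Mathlib.RingTheory.Ideal.IsPrimary
import Mathlib.RingTheory.LocalRing.ResidueField.Basic
import Mathlib.RingTheory.Localization.AtPrime.Basic
import Mathlib.RingTheory.Localization.Ideal
import Mathlib.RingTheory.Polynomial.Basic
import Mathlib.RingTheory.PolynomialAlgebra
import Mathlib.RingTheory.Localization.Algebra
import Mathlib.Algebra.Polynomial.Taylor
import Literature.AlgebraicGeometry.Resolution.ArithmeticalThreefoldsLocalProofs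
import HarnessLib

/-!
# CP frames at a NEAR point: the fibre polynomial is `(X − θ̄)^m` and the translate is again a frame [OURS · L1 W4.2 · D18]

Ladder W4.2 (`Summits/…/LADDER-RESOLUTION.md`), crux chain w42, D18 (near-point persistence of CP frames), object
(NEAR-SHAPE) of res-D-pv-050's D18 roadmap (HANDOFF 2026-08-27 11:33Z), cut (ET) of RULING v3.14-16a. Pure commutative algebra,
no schemes, 0 definitions.

Setting: `S` a commutative ring, `h ∈ S[X]` MONIC of degree `m ≥ 1`, `𝔔 ⊂ S[X]` a prime lying over a prime `𝔮 ⊂ S`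
(`𝔔 ∩ S = 𝔮`), at which `h` has ORDER `≥ m`: `s · h ∈ 𝔔^m` for some `s ∉ 𝔔` (equivalently `h ∈ 𝔪^m` in `S[X]_𝔔`,
`exists_mul_mem_pow_of_algebraMap_mem_pow`). This is the algebra of a point `x'` of the first chart
`Spec S[X']/(h')`, `S = R[I_J/u_{j₀}]`, of the blow-up of a CP-frame hypersurface `R[X]/(h)` at which the multiplicity `m`
PERSISTS (`x'` near to `x`).

* `eq_X_sub_C_pow_of_pow_dvd` (A): over a field, a monic `f` of degree `m ≥ 1` divisible by `P^m` with `P` non-constant is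
  `(X − θ)^m`.
* `exists_map_residue_eq_X_sub_C_pow` (B, `S` local, `𝔔 ⊇ 𝔪_S`): the fibre polynomial `h̄ ∈ κ_S[X]` is `(X − θ̄)^m` and
  `𝔔̄ = (X − θ̄)`: reduce to `κ_S[X]` (a PID), where `𝔔̄ = (P)` with `P` prime, `P ∤ s̄` and `P^m ∣ s̄ h̄`.
* `exists_eq_map_C_sup_span_X_sub_C` (B′): lifting `θ̄` to `θ' ∈ S`, `𝔔 = 𝔪_S S[X] + (X − θ')` is MAXIMAL with residue field
  `κ_S` (the near point is `κ_S`-rational on the `X`-line) and `h ∈ 𝔔^m` honestly (`𝔔^m` is `𝔔`-primary).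
* `coeff_comp_X_add_C_mem_pow` (C): `h ∈ (𝔪_S S[X] + (X − θ'))^n ⇒ coeff_i h(X + θ') ∈ 𝔪_S^{n−i}` (Taylor expansion at a
  rational point, `Literature…Polynomial.mem_sup_span_X_sub_C_pow_iff`, [CossartPiltant2019, Ch. 2 (2.3)]).
* `exists_frame_translate_of_order` (A+B+C, local form) and `exists_frame_translate_localization_of_order` (D2, any base `S`,
  prime `𝔮`, conclusion in `S_𝔮[X]` — Mathlib `Polynomial.isLocalization` moves `𝔔` to `S_𝔮[X]` and back): for some `θ'`,
  the translate `h₁ = h(X + θ')` is monic of degree `m` with `coeff_i h₁ ∈ 𝔪^{m−i}` for `i < m` — i.e. `(S_𝔮, h₁)` satisfies the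
  frame hypotheses `hmo/hm/hco` of `…CPFrameCurveGermAlgebra` / `…CPFrameCurveGermTransfer` (δ ≥ 1), and the weak form
  `coeff_i h₁ ∈ 𝔪` is the input `hθ` of `adjoinRoot_localization_of_fibre` (`…WLadderCPFrameLocalChart`).

What remains OUTSIDE this file (scheme side, D18 (i) successor): reading the order hypothesis off the Hilbert–Samuel equality
`H_{x'} = H_x` for the hypersurface germ `𝒪_{x'} = S[X']_𝔔/(h')`.
-/

set_option linter.dupNamespace false

noncomputable section

open Polynomial IsLocalRing

namespace Summit.ResolutionOfSingularities.ResolutionOfSingularities.Theorems.SigmaMaxModificationsCorridor3.Helpers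

/-- (A) a monic polynomial of degree `m ≥ 1` divisible by the `m`-th power of a non-constant polynomial `P` is `(X − θ)^m`. -/
theorem eq_X_sub_C_pow_of_pow_dvd {K : Type*} [Field K] {f P : K[X]} (hf : f.Monic) (hm : 0 < f.natDegree)
    (hP : 0 < P.natDegree) (hdvd : P ^ f.natDegree ∣ f) :
    ∃ θ : K, f = (X - C θ) ^ f.natDegree := by
  have hf0 : f ≠ 0 := hf.ne_zero
  have hdeg : (P ^ f.natDegree).natDegree ≤ f.natDegree := natDegree_le_of_dvd hdvd hf0
  rw [natDegree_pow] at hdeg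
  have hP1 : P.natDegree = 1 := by
    have h1 : f.natDegree * P.natDegree ≤ f.natDegree * 1 := by simpa using hdeg
    have := Nat.le_of_mul_le_mul_left h1 hm
    omega
  obtain ⟨θ, hθ⟩ : ∃ θ, P.IsRoot θ := exists_root_of_degree_eq_one ((degree_eq_iff_natDegree_eq (by
    rintro rfl; simp at hP)).mpr hP1)
  have hXP : X - C θ ∣ P := dvd_iff_isRoot.mpr hθ
  have hdvd' : (X - C θ) ^ f.natDegree ∣ f := (pow_dvd_pow_of_dvd hXP _).trans hdvd
  refine ⟨θ, ?_⟩
  refine (eq_of_monic_of_dvd_of_natDegree_le ((monic_X_sub_C θ).pow _) hf hdvd' ?_)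
  rw [natDegree_pow, natDegree_X_sub_C, mul_one]

variable {S : Type*} [CommRing S] [IsLocalRing S]

/-- The reduction map `S[X] → κ_S[X]` is surjective with kernel `𝔪_S · S[X]`. -/
theorem ker_mapRingHom_residue :
    RingHom.ker (mapRingHom (residue S)) = (maximalIdeal S).map (C : S →+* S[X]) := by
  rw [ker_mapRingHom, ker_residue]

/-- (B, over the residue field) **fibre polynomial at a point of multiplicity `m` is `(X − θ̄)^m`.** Let `S` be local, `h ∈ S[X]`
monic of degree `m ≥ 1`, `𝔔 ⊂ S[X]` a prime containing `𝔪_S` such that `h` has order `≥ m` at `𝔔` (`s · h ∈ 𝔔^m` for some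
`s ∉ 𝔔`). Then the reduction `h̄ ∈ κ_S[X]` is `(X − θ̄)^m` for some `θ̄`, and `𝔔̄ = (X − θ̄)`. -/
theorem exists_map_residue_eq_X_sub_C_pow {h : S[X]} (hmo : h.Monic) (hm : 0 < h.natDegree)
    {𝔔 : Ideal S[X]} [𝔔.IsPrime] (hle : maximalIdeal S ≤ 𝔔.comap C)
    (hord : ∃ s ∉ 𝔔, s * h ∈ 𝔔 ^ h.natDegree) :
    ∃ θ : ResidueField S, h.map (residue S) = (X - C θ) ^ h.natDegree ∧
      𝔔.map (mapRingHom (residue S)) = Ideal.span {X - C θ} := by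
  set ψ : S[X] →+* (ResidueField S)[X] := mapRingHom (residue S) with hψ
  have hsurj : Function.Surjective ψ := map_surjective _ residue_surjective
  have hker : RingHom.ker ψ ≤ 𝔔 := by
    rw [hψ, ker_mapRingHom_residue]
    exact Ideal.map_le_iff_le_comap.mpr hle
  -- the image prime `𝔔̄`
  set 𝔔' : Ideal (ResidueField S)[X] := 𝔔.map ψ with h𝔔'
  haveI h𝔔'p : 𝔔'.IsPrime := Ideal.map_isPrime_of_surjective hsurj hker
  have hcomap : 𝔔'.comap ψ = 𝔔 := by
    rw [h𝔔', Ideal.comap_map_of_surjective ψ hsurj, ← RingHom.ker_eq_comap_bot, sup_eq_left.mpr hker]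
  obtain ⟨s, hs, hsh⟩ := hord
  -- `h ∈ 𝔔`, so `h̄ ∈ 𝔔̄ ≠ 0`
  have hψh : ψ h = h.map (residue S) := rfl
  have hmo' : (h.map (residue S)).Monic := hmo.map _
  have hdeg' : (h.map (residue S)).natDegree = h.natDegree := hmo.natDegree_map _
  have hhQ : h ∈ 𝔔 := by
    have h1 : s * h ∈ 𝔔 := Ideal.pow_le_self hm.ne' hsh
    exact ((Ideal.IsPrime.mem_or_mem ‹𝔔.IsPrime› h1).resolve_left hs)
  have hne : 𝔔' ≠ ⊥ := by
    intro hbot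
    have : ψ h ∈ 𝔔' := Ideal.mem_map_of_mem _ hhQ
    rw [hbot, Ideal.mem_bot, hψh] at this
    exact hmo'.ne_zero this
  -- `𝔔̄ = (P)` with `P` prime
  haveI : 𝔔'.IsPrincipal := IsPrincipalIdealRing.principal 𝔔'
  set P := Submodule.IsPrincipal.generator 𝔔' with hPdef
  have hP : Prime P := Submodule.IsPrincipal.prime_generator_of_isPrime 𝔔' hne
  have hspan : 𝔔' = Ideal.span {P} := (Ideal.span_singleton_generator 𝔔').symm
  -- `P^m ∣ ψ(s) · h̄` and `P ∤ ψ(s)`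
  have hmem : ψ s * ψ h ∈ 𝔔' ^ h.natDegree := by
    rw [← map_mul, h𝔔', ← Ideal.map_pow]
    exact Ideal.mem_map_of_mem _ hsh
  rw [hspan, Ideal.span_singleton_pow, Ideal.mem_span_singleton] at hmem
  have hnot : ¬ P ∣ ψ s := by
    intro hd
    apply hs
    rw [← hcomap, Ideal.mem_comap, hspan, Ideal.mem_span_singleton]
    exact hd
  have hdvd : P ^ h.natDegree ∣ h.map (residue S) := hψh ▸ hP.pow_dvd_of_dvd_mul_left _ hnot hmem
  have hPdeg : 0 < P.natDegree := natDegree_pos_iff_degree_pos.mpr (degree_pos_of_irreducible hP.irreducible)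
  obtain ⟨θ, hθ⟩ := eq_X_sub_C_pow_of_pow_dvd hmo' (hdeg'.symm ▸ hm) hPdeg (hdeg'.symm ▸ hdvd)
  rw [hdeg'] at hθ
  refine ⟨θ, hθ, ?_⟩
  -- `𝔔̄ ∋ (X − θ̄)^m`, hence `X − θ̄ ∈ 𝔔̄`, a maximal ideal inside the proper `𝔔̄`
  have hXθ : X - C θ ∈ 𝔔' := by
    refine Ideal.IsPrime.mem_of_pow_mem ‹𝔔'.IsPrime› h.natDegree ?_
    rw [← hθ, ← hψh]
    exact Ideal.mem_map_of_mem _ hhQ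
  haveI hmax : (Ideal.span {X - C θ} : Ideal (ResidueField S)[X]).IsMaximal :=
    PrincipalIdealRing.isMaximal_of_irreducible (irreducible_X_sub_C θ)
  exact (hmax.eq_of_le h𝔔'p.ne_top ((Ideal.span_singleton_le_iff_mem _).mpr hXθ)).symm

/-- (B′) **the point is rational and is the translated frame origin.** Under the hypotheses of
`exists_map_residue_eq_X_sub_C_pow`, there is `θ' ∈ S` with `𝔔 = 𝔪_S · S[X] + (X − θ')` (so `𝔔` is maximal with residue
field `κ_S`), the fibre polynomial is `(X − θ̄')^m`, and `h ∈ 𝔔^m` (honest power: `𝔔^m` is primary to the maximal `𝔔`). -/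
theorem exists_eq_map_C_sup_span_X_sub_C {h : S[X]} (hmo : h.Monic) (hm : 0 < h.natDegree)
    {𝔔 : Ideal S[X]} [𝔔.IsPrime] (hle : maximalIdeal S ≤ 𝔔.comap C)
    (hord : ∃ s ∉ 𝔔, s * h ∈ 𝔔 ^ h.natDegree) :
    ∃ θ' : S, 𝔔 = (maximalIdeal S).map (C : S →+* S[X]) ⊔ Ideal.span {X - C θ'} ∧ 𝔔.IsMaximal ∧
      h.map (residue S) = (X - C (residue S θ')) ^ h.natDegree ∧ h ∈ 𝔔 ^ h.natDegree := by
  obtain ⟨θ, hθ, h𝔔'⟩ := exists_map_residue_eq_X_sub_C_pow hmo hm hle hord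
  obtain ⟨θ', rfl⟩ := residue_surjective θ
  set ψ : S[X] →+* (ResidueField S)[X] := mapRingHom (residue S) with hψ
  have hsurj : Function.Surjective ψ := map_surjective _ residue_surjective
  have hker : RingHom.ker ψ ≤ 𝔔 := by
    rw [hψ, ker_mapRingHom_residue]
    exact Ideal.map_le_iff_le_comap.mpr hle
  have hcomap : (𝔔.map ψ).comap ψ = 𝔔 := by
    rw [Ideal.comap_map_of_surjective ψ hsurj, ← RingHom.ker_eq_comap_bot, sup_eq_left.mpr hker]
  have hψX : ψ (X - C θ') = X - C (residue S θ') := by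
    rw [map_sub, hψ, coe_mapRingHom, map_X, map_C]
  have heq : 𝔔 = (maximalIdeal S).map (C : S →+* S[X]) ⊔ Ideal.span {X - C θ'} := by
    rw [← hcomap, h𝔔', ← hψX, ← Set.image_singleton, ← Ideal.map_span, Ideal.comap_map_of_surjective ψ hsurj,
      ← RingHom.ker_eq_comap_bot, hψ, ker_mapRingHom_residue, sup_comm]
  haveI hmax : 𝔔.IsMaximal := by
    haveI : (Ideal.span {X - C (residue S θ')} : Ideal (ResidueField S)[X]).IsMaximal :=
      PrincipalIdealRing.isMaximal_of_irreducible (irreducible_X_sub_C _)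
    rw [← hcomap, h𝔔']
    exact Ideal.comap_isMaximal_of_surjective ψ hsurj
  refine ⟨θ', heq, hmax, hθ, ?_⟩
  -- `𝔔^m` is `𝔔`-primary
  have hprim : (𝔔 ^ h.natDegree).IsPrimary := by
    refine Ideal.isPrimary_of_isMaximal_radical ?_
    rw [Ideal.radical_pow _ hm.ne', Ideal.IsPrime.radical ‹𝔔.IsPrime›]
    exact hmax
  obtain ⟨s, hs, hsh⟩ := hord
  rcases (Ideal.isPrimary_iff.mp hprim).2 (mul_comm s h ▸ hsh) with hh | hs'
  · exact hh
  · rw [Ideal.radical_pow _ hm.ne', Ideal.IsPrime.radical ‹𝔔.IsPrime›] at hs'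
    exact absurd hs' hs

/-- (C) **the translate `h(X + θ')` is a hypersurface frame: `coeff_i ∈ 𝔪_S^{m−i}`.** If
`𝔔 = 𝔪_S · S[X] + (X − θ')` and `h ∈ 𝔔^n`, then every coefficient of `h(X + θ')` of index `i` lies in `𝔪_S^{n−i}` (the
Taylor expansion at the rational point; `Literature…Polynomial.mem_sup_span_X_sub_C_pow_iff`, [CossartPiltant2019, (2.3)]). -/
theorem coeff_comp_X_add_C_mem_pow {𝔔 : Ideal S[X]} {θ' : S}
    (h𝔔 : 𝔔 = (maximalIdeal S).map (C : S →+* S[X]) ⊔ Ideal.span {X - C θ'}) {n : ℕ} {h : S[X]} (hh : h ∈ 𝔔 ^ n)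
    (i : ℕ) : (h.comp (X + C θ')).coeff i ∈ maximalIdeal S ^ (n - i) := by
  rw [h𝔔, Literature.AlgebraicGeometry.Resolution.Polynomial.mem_sup_span_X_sub_C_pow_iff] at hh
  rw [← taylor_apply]
  exact hh i

/-- (A)+(B)+(C) **NEAR-SHAPE, local form.** `S` local, `h ∈ S[X]` monic of degree `m ≥ 1`, `𝔔 ⊂ S[X]` a prime over `𝔪_S`
at which `h` has order `≥ m` (`s · h ∈ 𝔔^m`, `s ∉ 𝔔`). Then for some `θ' ∈ S`: `𝔔 = 𝔪_S S[X] + (X − θ')`, the fibre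
polynomial is `h̄ = (X − θ̄')^m`, and the translate `h₁ := h(X + θ')` is monic of degree `m` with `coeff_i h₁ ∈ 𝔪_S^{m−i}`
for `i < m` — i.e. `(S, h₁)` is again a hypersurface frame with `δ ≥ 1` (the input `hmo/hm/hco` of
`surjective_algebraMap_quotient_of_frame`, `exists_isRsopPart_span_eq_of_frame`, …CPFrameCurveGermAlgebra). Read at a NEAR
point `x'` of the first chart of the blow-up of a CP frame (`S = R[I_J/u_{j₀}]_𝔮`, `h = h'` the monic transform): `x'` is
`κ(𝔮)`-rational on the `X'`-line and `h'(X' + θ')` is a frame polynomial. -/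
theorem exists_frame_translate_of_order {h : S[X]} (hmo : h.Monic) (hm : 0 < h.natDegree)
    {𝔔 : Ideal S[X]} [𝔔.IsPrime] (hle : maximalIdeal S ≤ 𝔔.comap C)
    (hord : ∃ s ∉ 𝔔, s * h ∈ 𝔔 ^ h.natDegree) :
    ∃ θ' : S, 𝔔 = (maximalIdeal S).map (C : S →+* S[X]) ⊔ Ideal.span {X - C θ'} ∧
      h.map (residue S) = (X - C (residue S θ')) ^ h.natDegree ∧
      (h.comp (X + C θ')).Monic ∧ (h.comp (X + C θ')).natDegree = h.natDegree ∧
      ∀ i < h.natDegree, (h.comp (X + C θ')).coeff i ∈ maximalIdeal S ^ (h.natDegree - i) := by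
  obtain ⟨θ', h𝔔, _, hθ, hh⟩ := exists_eq_map_C_sup_span_X_sub_C hmo hm hle hord
  refine ⟨θ', h𝔔, hθ, hmo.comp (monic_X_add_C θ') (by rw [natDegree_X_add_C]; exact one_ne_zero), ?_,
    fun i _ => coeff_comp_X_add_C_mem_pow h𝔔 hh i⟩
  rw [← taylor_apply, natDegree_taylor]

/-- (D1) **order in the local ring ⇒ the elementwise form.** `h ∈ 𝔪^m` in `S[X]_𝔔` iff `s · h ∈ 𝔔^m` for some `s ∉ 𝔔`
(Mathlib `IsLocalization.algebraMap_mem_map_algebraMap_iff`); we record the direction used above, for any commutative ring. -/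
theorem exists_mul_mem_pow_of_algebraMap_mem_pow {A : Type*} [CommRing A] {𝔔 : Ideal A} [𝔔.IsPrime] {h : A} {m : ℕ}
    (hord : algebraMap A (Localization.AtPrime 𝔔) h ∈ maximalIdeal (Localization.AtPrime 𝔔) ^ m) :
    ∃ s ∉ 𝔔, s * h ∈ 𝔔 ^ m := by
  rw [← Localization.AtPrime.map_eq_maximalIdeal, ← Ideal.map_pow,
    IsLocalization.algebraMap_mem_map_algebraMap_iff 𝔔.primeCompl] at hord
  obtain ⟨s, hs, hsh⟩ := hord
  exact ⟨s, hs, hsh⟩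

end Summit.ResolutionOfSingularities.ResolutionOfSingularities.Theorems.SigmaMaxModificationsCorridor3.Helpers

namespace Summit.ResolutionOfSingularities.ResolutionOfSingularities.Theorems.SigmaMaxModificationsCorridor3.Helpers

/-- (D2) **NEAR-SHAPE over a prime `𝔮` of any base `S`** (the form consumed by `adjoinRoot_localization_of_fibre`,
…CPFrameLocalChart): `h ∈ S[X]` monic of degree `m ≥ 1`, `𝔔 ⊂ S[X]` a prime with `𝔔 ∩ S = 𝔮` at which `h` has order `≥ m`.
Then in `S_𝔮[X]` the extended prime `𝔔 S_𝔮[X]` is `𝔪_{S_𝔮} S_𝔮[X] + (X − θ')` for some `θ' ∈ S_𝔮`, it contracts back to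
`𝔔`, the fibre polynomial of `h` over `κ(𝔮)` is `(X − θ̄')^m`, and the translate `h(X + θ')` is monic of degree `m` with
`coeff_i ∈ 𝔪_{S_𝔮}^{m−i}` (in particular `∈ 𝔪_{S_𝔮}`) for `i < m`. -/
theorem exists_frame_translate_localization_of_order {S : Type*} [CommRing S] (q : Ideal S) [q.IsPrime]
    {h : S[X]} (hmo : h.Monic) (hm : 0 < h.natDegree) {𝔔 : Ideal S[X]} [𝔔.IsPrime] (h𝔔 : 𝔔.comap C = q)
    (hord : ∃ s ∉ 𝔔, s * h ∈ 𝔔 ^ h.natDegree) :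
    ∃ θ' : Localization.AtPrime q,
      𝔔.map (mapRingHom (algebraMap S (Localization.AtPrime q))) =
        (maximalIdeal (Localization.AtPrime q)).map (C : _ →+* (Localization.AtPrime q)[X]) ⊔ Ideal.span {X - C θ'} ∧
      (𝔔.map (mapRingHom (algebraMap S (Localization.AtPrime q)))).comap
        (mapRingHom (algebraMap S (Localization.AtPrime q))) = 𝔔 ∧
      (h.map (algebraMap S (Localization.AtPrime q))).map (residue (Localization.AtPrime q)) =
        (X - C (residue _ θ')) ^ h.natDegree ∧
      ((h.map (algebraMap S (Localization.AtPrime q))).comp (X + C θ')).Monic ∧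
      ((h.map (algebraMap S (Localization.AtPrime q))).comp (X + C θ')).natDegree = h.natDegree ∧
      (∀ i < h.natDegree, ((h.map (algebraMap S (Localization.AtPrime q))).comp (X + C θ')).coeff i ∈
        maximalIdeal (Localization.AtPrime q) ^ (h.natDegree - i)) ∧
      (∀ i < h.natDegree, ((h.map (algebraMap S (Localization.AtPrime q))).comp (X + C θ')).coeff i ∈
        maximalIdeal (Localization.AtPrime q)) := by
  letI : Algebra S[X] (Localization.AtPrime q)[X] := Polynomial.algebra S (Localization.AtPrime q)
  haveI : IsLocalization (q.primeCompl.map (C : S →+* S[X])) (Localization.AtPrime q)[X] :=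
    Polynomial.isLocalization q.primeCompl (Localization.AtPrime q)
  have halg : algebraMap S[X] (Localization.AtPrime q)[X] = mapRingHom (algebraMap S (Localization.AtPrime q)) := rfl
  -- `𝔔` misses the constants `C(S ∖ 𝔮)`
  have hdisj : Disjoint ((q.primeCompl.map (C : S →+* S[X]) : Submonoid S[X]) : Set S[X]) (𝔔 : Set S[X]) := by
    refine Set.disjoint_left.mpr ?_
    rintro _ ⟨s, hs, rfl⟩ hmem
    exact hs (h𝔔 ▸ Ideal.mem_comap.mpr hmem : s ∈ q)
  haveI h𝔔q : (𝔔.map (mapRingHom (algebraMap S (Localization.AtPrime q)))).IsPrime :=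
    halg ▸ IsLocalization.isPrime_of_isPrime_disjoint (q.primeCompl.map (C : S →+* S[X])) _ 𝔔 ‹𝔔.IsPrime› hdisj
  have hcomap : (𝔔.map (mapRingHom (algebraMap S (Localization.AtPrime q)))).comap
      (mapRingHom (algebraMap S (Localization.AtPrime q))) = 𝔔 := by
    have h1 := IsLocalization.under_map_of_isPrime_disjoint (q.primeCompl.map (C : S →+* S[X]))
      (Localization.AtPrime q)[X] ‹𝔔.IsPrime› hdisj
    rwa [Ideal.under_def, halg] at h1
  -- `𝔪_{S_𝔮} ⊆ 𝔔 S_𝔮[X] ∩ S_𝔮`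
  have hle : maximalIdeal (Localization.AtPrime q) ≤
      (𝔔.map (mapRingHom (algebraMap S (Localization.AtPrime q)))).comap C := by
    rw [← Localization.AtPrime.map_eq_maximalIdeal, Ideal.map_le_iff_le_comap.symm, Ideal.map_map,
      ← Polynomial.mapRingHom_comp_C, ← Ideal.map_map]
    exact Ideal.map_mono (Ideal.map_le_iff_le_comap.mpr h𝔔.ge)
  -- the order transfers
  have hmo' : (h.map (algebraMap S (Localization.AtPrime q))).Monic := hmo.map _
  have hdeg' : (h.map (algebraMap S (Localization.AtPrime q))).natDegree = h.natDegree := hmo.natDegree_map _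
  have hord' : ∃ s ∉ 𝔔.map (mapRingHom (algebraMap S (Localization.AtPrime q))),
      s * h.map (algebraMap S (Localization.AtPrime q)) ∈
        𝔔.map (mapRingHom (algebraMap S (Localization.AtPrime q))) ^
          (h.map (algebraMap S (Localization.AtPrime q))).natDegree := by
    obtain ⟨s, hs, hsh⟩ := hord
    refine ⟨mapRingHom (algebraMap S (Localization.AtPrime q)) s, fun hs' => hs ?_, ?_⟩
    · rw [← hcomap]
      exact Ideal.mem_comap.mpr hs'
    · rw [hdeg', ← Ideal.map_pow, ← coe_mapRingHom, ← map_mul]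
      exact Ideal.mem_map_of_mem _ hsh
  obtain ⟨θ', h1, h2, h3, h4, h5⟩ := exists_frame_translate_of_order hmo' (hdeg'.symm ▸ hm) hle hord'
  rw [hdeg'] at h2 h4 h5
  exact ⟨θ', h1, hcomap, h2, h3, h4, h5, fun i hi => Ideal.pow_le_self (by omega) (h5 i hi)⟩

end Summit.ResolutionOfSingularities.ResolutionOfSingularities.Theorems.SigmaMaxModificationsCorridor3.Helpers

end
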